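import Literature.MathematicalPhysics.QuantumFieldTheory.Balaban1983to89.B9Thm37GpTorusRegularCubes

/-!
# `Balaban1983to89.B9Thm37CutoffGradTerms` — T. Bałaban, *Propagators for lattice gauge theories in a background field*, Commun. Math. Phys. **99**
# (1985) 389–434 [Balaban1985BackgroundPropagators], Sect. C pp. 409–410: the LEFT-ENTRY CUBE TERMS `∇_{U,μ}(h_□G′_□h_□)` and `Δ_U(h_□G′_□h_□)` of the
# expansion (3.87)∕(3.90), bounded POINTWISE over the gauge-invariant test class from the cube letter's (3.42) entries and the sizes of the cut-off
# `h_□`, and their localized block majorants — the `hTE μ` ∕ `hTL` slots of `B9Thm37GpTorusRegularEntries` at one cube of the cover of record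

statement-level skeleton of published theorems with citation tags; proofs where landed; nothing here is a claim about the Yang–Mills mass gap

PDF held: `paper:balaban1985-cmp99-background-propagators` (journal page = PDF page + 388); pp. 397, 409–410, 413 read from the held text layer;
[4] = [Balaban1984PropagatorsII] pp. 230, 234.

THE PRINT.  p. 409 (3.87) *«G′₀ = Σ_{□∈𝒟} h_□G′_□h_□»*; Theorem 3.7 p. 409: *«The expansion is convergent in all norms appearing in the inequalities
(3.42)–(3.47)»*; p. 410: *«This theorem follows simply from Corollary 3.6 holding for all G′_□ … Theorem 3.7 implies that all the inequalities
(3.42)–(3.47) hold for G′»*; p. 413 (3.100): *«(D_μhA)(x) = h(x)(D_μA)(x) + (∂_μh)(x)R(U(x,x+ηe_μ))A(x+ηe_μ)»* (the lattice Leibniz rule of the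
covariant difference through a scalar cut-off); p. 409 (3.88), first line: *«(Δ′_a hλ)(x) = h(x)(Δ′_aλ)(x) − Σ_{b∈st(x)}(∂h)(b)(Dλ)(b) + (Δh)(x)λ(x) + …»*;
[4] p. 234: *«The similar inequalities hold for a derivative of G′λ … but with (Lʲη)² replaced by Lʲη»*; [4] p. 230 (2.44): the commutator terms are
`O(M⁻¹)` (our `|∂h_□| ≤ C1F∕(8∕5·S_j)`, `|Δh_□| ≤ (d+1)C2F²∕(8∕5·S_j)²`, p38's `B9Thm37CubeCoverCommutatorSizes(Grad)`).

WHY THIS FILE (cell context: G-B9-LETTERS, module M5.5 FILE 4a; consumer = FILE 4c `B9Thm37GpTorusRegularEntriesCubes`, which feeds the `hTE μ`∕`hTL`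
slots of FILE 2 `B9Thm37GpTorusRegularEntries.eBlock_kernelFamilySInv_Gp_of_cubes` at the cube cover of record).  For a cube letter `O` (= `G′_□(V)`)
whose (3.42) entries over the invariant class are DISPLAYED (`h342₀`, `h342₁`, `h342₃` — the pointwise READ shapes of `B9CubeLettersInvReadDict` §3,
exactly as in p38's `B9Thm37CommutatorBound389.norm_KhY_O_hTY_apply_le`), the cut-off `h_□ = hTY i c` of the partition of record and a test function
`Λ` of the class of `f` (`supp f ⊂ Δ(βy′)`), we bound at `z ∈ Δ(βy)`:
* §1 (Leibniz, (3.100)) `∇_{V,μ}(h_□Ψ)(z) = h_□(z+e_μ)·(∇_{V,μ}Ψ)(z) + (h_□(z+e_μ) − h_□(z))·Ψ(z)` and, with `Ψ = O(h_□Λ)`,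
  ★★ `eta_norm_cdS_hOh_le`: `η‖∇_{V,μ}(h_□O(h_□Λ))(z)‖ ≤ B₀(1 + (5∕8)C1F∕M_h)·ℓ(y)·e^{−δd(y,y′)}·|f|` — the gradient entry of the localized term
  «with (Lʲη)² replaced by Lʲη» (the commutator piece costs `|∂h_□|·η⁻¹·B₀ℓ(y)² = O(M⁻¹)B₀ℓ(y)` because `ℓ(y)∕η = L^{lev z} ≤ L^{j+1}` near `□`);
* §2 ★★ `norm_lapS_hOh_le`: `‖Δ_V(h_□O(h_□Λ))(z)‖ ≤ (B₀ + θ₃₈₉∕(L·M_h))·e^{−δd(y,y′)}·|f|` — the Laplacian entry (the first line of (3.88): the commutator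
  `K_Δ(h_□)` sized by p38's `norm_cutCommY_lapSL_apply_le_grad` and the level bookkeeping `arith389`, the backward bonds read at the neighbour
  `z − e_μ` as in p38's proof);
* both vanish unless `Δ(z) ∈ QT □` (output localisation: `supp h_□` one step away), and §3 turns them into the LOCALIZED BLOCK MAJORANTS
  `1_{S}(a)·M₂(Σ_j‖b_j‖)·θ·w(a)·e^{−δd(a,a′)}` of the conjugated operators (`B9CubeLettersInvReadDict`∕def-Y's `hasMajorant_conj_of_ball_bound`), `w = ℓ`
  resp. `1` — the shapes `KE μ □`, `KL □` of FILE 2.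
Nothing of (3.42) for the cube letter, of the sizes of `h_□`, or of Theorem 3.7 is asserted: all displayed or cited by name; corner-free members
(`ιB` a section of `β`), `η = |c_f|⁻¹`, bi-contractive bond variables, as in the sibling modules.

WHAT IS PROVED (all `theorem`s, no `sorry`).  §0 `mem_QT_and_lev_of_near`, `torusSupNorm_sub_self_le_one`, `len_eq_pow_mul_eta`, `norm_O_le_at`, `norm_cdS_O_le_at`,
`norm_cdsS_O_le_at`; §1 `cdS_cutMulY_eq`, `cdS_hOh_eq_zero_of_far`, ★★ `eta_norm_cdS_hOh_le`; §2 `lapS_cutMulY_eq`, `lapS_hOh_eq_zero_of_far`,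
★★ `norm_lapS_hOh_le`; §3 `smul_comm_of_eq_grad`, `smul_comm_of_eq_lap`, ★★ `hasMajorant_conj_gradTerm`, ★★ `hasMajorant_conj_lapTerm`.
-/

noncomputable section

namespace Literature.MathematicalPhysics.QuantumFieldTheory.Balaban1983to89.B9Thm37CutoffGradTerms

open Node00
open B9Thm37CubeCoverCommutators
open B9Thm37CubeCoverCommutatorSizes
open B9Thm37CubeCoverCommutatorSizesGrad
open B9Thm37CommutatorBound389 (norm_cutMulY_le_of_le norm_cdsS_le_norm_cdS_shift lev_le_succ_of_touch torusSupNorm_sub_shiftY_le_one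
  dist_blkOf_le_one_of_touch geo9K_dist_eq geo9K_len_eq levY_eq_lvl_of_blkOf_eq blkOf_fst_fst theta389 theta389_nonneg arith389)
open B9Thm37CommutatorBound389Majorant (norm_liftY_le)
open B9Thm37GpTorusRegularCubes (SQT mem_SQT)
open B6KLevelCensusIndexV1 (KIdx)
open B6Ineq2142KLevelV1 (β lvl)
open B4TorusKernel.MultiPeriod (torusSupNorm)
open B6MultiLevelBoxOperator (bigSide bigSide_eq one_le_bigSide)
open B6MultiLevelTorusOperator (one_le_of_mem)
open B6Geom246MultiLevelBox (bset blkOf)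
open B6Geom246MultiLevelTorus (bondT connectedT)
open B6Cover236MultiLevelBlocks (cubes)
open B6Partition118KLevelTorus (hT abs_hT_le_one)
open B6Partition118KLevelTorusCentral (QT pow_le_half_bigSide)
open B6Partition118KLevelFineSizes (C1F C1F_nonneg)
open B6Partition118KLevelFineSecond (C2F C2F_nonneg)
open B6Partition118KLevelTorusBinders (sLipT sLipT_nonneg lev_le_of_near_suppT)
open B6RandomWalk (HasMajorant hasMajorant_mono)
open B9Thm34Ext (toB6)
open B9GeoNormsKLevelV1 (geo9K geo9K_supNorm_nonneg)
open B9Ineq349SiteComposite (etaS_pos)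
open B9Eq352DivFormLetters (conj)
open B9Eq39Adjoint (R R_inv_R R_smul R_sub)
open scoped Matrix

variable {𝔸 : Type} [NormedRing 𝔸] [NormedAlgebra ℂ 𝔸] [CompleteSpace 𝔸]
variable {d ℓ : ℕ} {hd : 1 ≤ d + 1} {hL : Odd (ℓ + 1) ∧ 1 < ℓ + 1} {b₀ b₁ : ℝ}
variable {ι : Type} [Fintype ι]
variable (i : KIdx d ℓ hd hL b₀ b₁) (b : Module.Basis ι ℝ 𝔸)

/-! ## §0 Geometry near `supp h_□`; the cube letter's entries at a member of the class -/

/-- **ONE STEP FROM `supp h_□`: the block is in `QT □` and its level is `≤ j + 1`** (the reach of the cube and (2.2)).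
[cite: Balaban1985BackgroundPropagators, (3.89) p.409 («x ∈ Δ(y), … y, y′ ∈ □ ∈ 𝒟_j»); Balaban1984PropagatorsII, p.235, (2.2) p.224] -/
theorem mem_QT_and_lev_of_near (c : ↥(cubes i.D.toDomains)) {z u' : SiteY i} (hu' : hTY i c u' ≠ 0)
    (hzu : torusSupNorm (toKT i).NB (z.1 - u'.1) ≤ 1) :
    blkOf i.D.toDomains z ∈ QT i.D (B9GeoLemma21KLevelV1.one_le_Mh i) (four_le_P' i) c ∧ levY i z ≤ c.1.1 + 1 := by
  obtain ⟨hℓ, hMh, hR, hP5⟩ := side_conditions i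
  exact ⟨B6CubeCoeffSizesV1.blkOf_mem_QT_of_near_hT i.D hℓ i.hM8 hR hP5 (four_le_P' i) c hu' hzu,
    lev_le_of_near_suppT (D := i.D) hℓ hMh hR hP5 c hu' hzu⟩

/-- a site is within torus distance `1` of itself. [cite: Balaban1984PropagatorsII, (2.46) p.231, bookkeeping] -/
theorem torusSupNorm_sub_self_le_one (u : SiteY i) : torusSupNorm (toKT i).NB (u.1 - u.1) ≤ 1 := by
  rw [sub_self]
  have : torusSupNorm (toKT i).NB (0 : Fin (d + 1) → ℤ) ≤ B4ContourShift.supNorm (0 : Fin (d + 1) → ℤ) :=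
    B4TorusKernel.MultiPeriod.torusSupNorm_le_supNorm (one_le_of_mem u.2) _
  refine this.trans (B4Reflection242.supNorm_le_of_forall fun ν => ?_)
  simp

/-- the geometry's length on the block of `w`: `ℓ(y₁) = L^{lev w}·η` (`η = |c_f|⁻¹`). [cite: Balaban1984PropagatorsII, (2.1) p.224 («Lʲη»), dictionary] -/
theorem len_eq_pow_mul_eta (hη : etaS i = |i.cf|⁻¹) {w : SiteY i} {y₁ : IBondY i} (hw : blkOf i.D.toDomains w = β i.hN i.D i.hk y₁) :
    (geo9K i).len y₁ = ((ℓ : ℝ) + 1) ^ levY i w * etaS i := by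
  rw [geo9K_len_eq, ← levY_eq_lvl_of_blkOf_eq i hw, div_eq_mul_inv, hη]; push_cast; rfl

section Entries

variable (V : CfgY 𝔸 i) (O : (SiteY i → 𝔸) →ₗ[ℂ] (SiteY i → 𝔸)) {B₀ δ : ℝ}

omit [CompleteSpace 𝔸] in
/-- **THE VALUE ENTRY AT A MEMBER OF THE CLASS, ON THE BLOCK**: `‖(OΛ′)(w)‖ ≤ B₀·(L^{lev w})²·e^{−δd(y,y′)}|f|` for `w ∈ Δ(βy)` (the `η²` of (3.42)₁ against
`ℓ(y)² = (L^{lev w}η)²`). [cite: Balaban1985BackgroundPropagators, (3.42) p.397 (first member)] -/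
theorem norm_O_le_at (hη : etaS i = |i.cf|⁻¹)
    (h342₀ : ∀ (f : SiteY i → ℝ) (y y' : IBondY i), (geo9K i).suppIn (Sum.inl f) y' →
      ∀ Λ : SiteY i → 𝔸, (∀ z, ‖Λ z‖ ≤ |f z|) → ∀ z : SiteY i, blkOf i.D.toDomains z = β i.hN i.D i.hk y →
        etaS i ^ 2 * ‖O Λ z‖ ≤ B₀ * (geo9K i).len y ^ 2 * Real.exp (-(δ * (geo9K i).dist y y')) * (geo9K i).supNorm (Sum.inl f))
    (f : SiteY i → ℝ) (y y' : IBondY i) (hs : (geo9K i).suppIn (Sum.inl f) y')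
    (Λ' : SiteY i → 𝔸) (hΛ' : ∀ z, ‖Λ' z‖ ≤ |f z|) (w : SiteY i) (hw : blkOf i.D.toDomains w = β i.hN i.D i.hk y) :
    ‖O Λ' w‖ ≤ B₀ * (((ℓ : ℝ) + 1) ^ levY i w) ^ 2 * Real.exp (-(δ * (geo9K i).dist y y')) * (geo9K i).supNorm (Sum.inl f) := by
  have hη0 : 0 < etaS i := etaS_pos i
  have h := h342₀ f y y' hs Λ' hΛ' w hw
  rw [len_eq_pow_mul_eta i hη hw] at h
  have e1 : etaS i ^ 2 * ‖O Λ' w‖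
      ≤ etaS i ^ 2 * (B₀ * (((ℓ : ℝ) + 1) ^ levY i w) ^ 2 * Real.exp (-(δ * (geo9K i).dist y y')) * (geo9K i).supNorm (Sum.inl f)) :=
    h.trans (le_of_eq (by ring))
  exact le_of_mul_le_mul_left e1 (pow_pos hη0 2)

/-- **THE FORWARD GRADIENT ENTRY AT A MEMBER OF THE CLASS**: `‖(∇_{V,μ}OΛ′)(z)‖ ≤ B₀·L^{lev z}·e^{−δd(y,y′)}|f|` for `z ∈ Δ(βy)`.
[cite: Balaban1985BackgroundPropagators, (3.42) p.397 (second member)] -/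
theorem norm_cdS_O_le_at (hη : etaS i = |i.cf|⁻¹)
    (h342₁ : ∀ (f : SiteY i → ℝ) (y y' : IBondY i), (geo9K i).suppIn (Sum.inl f) y' →
      ∀ Λ : SiteY i → 𝔸, (∀ z, ‖Λ z‖ ≤ |f z|) → ∀ (z : SiteY i) (μ : Fin (d + 1)), blkOf i.D.toDomains z = β i.hN i.D i.hk y →
        etaS i * ‖cdS i V μ (O Λ) z‖ ≤ B₀ * (geo9K i).len y * Real.exp (-(δ * (geo9K i).dist y y')) * (geo9K i).supNorm (Sum.inl f))
    (f : SiteY i → ℝ) (y y' : IBondY i) (hs : (geo9K i).suppIn (Sum.inl f) y')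
    (Λ' : SiteY i → 𝔸) (hΛ' : ∀ z, ‖Λ' z‖ ≤ |f z|) (z : SiteY i) (μ : Fin (d + 1)) (hz : blkOf i.D.toDomains z = β i.hN i.D i.hk y) :
    ‖cdS i V μ (O Λ') z‖ ≤ B₀ * ((ℓ : ℝ) + 1) ^ levY i z * Real.exp (-(δ * (geo9K i).dist y y')) * (geo9K i).supNorm (Sum.inl f) := by
  have hη0 : 0 < etaS i := etaS_pos i
  have h := h342₁ f y y' hs Λ' hΛ' z μ hz
  rw [len_eq_pow_mul_eta i hη hz] at h
  have e1 : etaS i * ‖cdS i V μ (O Λ') z‖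
      ≤ etaS i * (B₀ * ((ℓ : ℝ) + 1) ^ levY i z * Real.exp (-(δ * (geo9K i).dist y y')) * (geo9K i).supNorm (Sum.inl f)) :=
    h.trans (le_of_eq (by ring))
  exact le_of_mul_le_mul_left e1 hη0

/-- **THE BACKWARD BOND AT A MEMBER OF THE CLASS, READ AT THE NEIGHBOUR** (p38's step in `norm_KhY_O_hTY_apply_le`): at bi-contractive bond
variables `‖(∇*_{V,μ}OΛ′)(z)‖ ≤ ‖(∇_{V,μ}OΛ′)(z − e_μ)‖ ≤ B₀·(L·e^{δ})·L^{lev z}·e^{−δd(y,y′)}|f|` (`z − e_μ` has level `≤ lev z + 1`, block at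
distance `≤ 1`). [cite: Balaban1985BackgroundPropagators, (3.8) p.392, (3.42) p.397 (second member), (3.88) p.409 («b ∈ st(x)»); Balaban1984PropagatorsII, (2.2) p.224] -/
theorem norm_cdsS_O_le_at (hB₀ : 0 ≤ B₀) (hδ : 0 ≤ δ) (hη : etaS i = |i.cf|⁻¹) (ιB : BlkY i → IBondY i) (hι : ∀ s, β i.hN i.D i.hk (ιB s) = s)
    (hV : ∀ (μ : Fin (d + 1)) (x : SiteY i), ‖(UboxY i V μ x : 𝔸)‖ ≤ 1 ∧ ‖(((UboxY i V μ x)⁻¹ : 𝔸ˣ) : 𝔸)‖ ≤ 1)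
    (h342₁ : ∀ (f : SiteY i → ℝ) (y y' : IBondY i), (geo9K i).suppIn (Sum.inl f) y' →
      ∀ Λ : SiteY i → 𝔸, (∀ z, ‖Λ z‖ ≤ |f z|) → ∀ (z : SiteY i) (μ : Fin (d + 1)), blkOf i.D.toDomains z = β i.hN i.D i.hk y →
        etaS i * ‖cdS i V μ (O Λ) z‖ ≤ B₀ * (geo9K i).len y * Real.exp (-(δ * (geo9K i).dist y y')) * (geo9K i).supNorm (Sum.inl f))
    (f : SiteY i → ℝ) (y y' : IBondY i) (hs : (geo9K i).suppIn (Sum.inl f) y')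
    (Λ' : SiteY i → 𝔸) (hΛ' : ∀ z, ‖Λ' z‖ ≤ |f z|) (z : SiteY i) (μ : Fin (d + 1)) (hz : blkOf i.D.toDomains z = β i.hN i.D i.hk y) :
    ‖cdsS i V μ (O Λ') z‖
      ≤ B₀ * (((ℓ : ℝ) + 1) * Real.exp δ) * ((ℓ : ℝ) + 1) ^ levY i z * Real.exp (-(δ * (geo9K i).dist y y')) * (geo9K i).supNorm (Sum.inl f) := by
  have hL1 : (1 : ℝ) ≤ (ℓ : ℝ) + 1 := by linarith [(Nat.cast_nonneg ℓ : (0 : ℝ) ≤ ℓ)]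
  have hF0 : 0 ≤ (geo9K i).supNorm (Sum.inl f) := geo9K_supNorm_nonneg i _
  set w : SiteY i := (shiftY i μ).symm z with hw
  have hwb : blkOf i.D.toDomains w = β i.hN i.D i.hk (ιB (blkOf i.D.toDomains w)) := by rw [hι]
  have h1 := norm_cdS_O_le_at i V O hη h342₁ f _ y' hs Λ' hΛ' w μ hwb
  have htouch : torusSupNorm (toKT i).NB (z.1 - w.1) ≤ 1 := (torusSupNorm_sub_shiftY_le_one i μ z).2
  have hpow : ((ℓ : ℝ) + 1) ^ levY i w ≤ ((ℓ : ℝ) + 1) * ((ℓ : ℝ) + 1) ^ levY i z := by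
    calc ((ℓ : ℝ) + 1) ^ levY i w ≤ ((ℓ : ℝ) + 1) ^ (levY i z + 1) := pow_le_pow_right₀ hL1 (lev_le_succ_of_touch i htouch)
      _ = ((ℓ : ℝ) + 1) * ((ℓ : ℝ) + 1) ^ levY i z := by rw [pow_succ]; ring
  have hdist : (geo9K i).dist y y' ≤ 1 + (geo9K i).dist (ιB (blkOf i.D.toDomains w)) y' := by
    rw [geo9K_dist_eq, geo9K_dist_eq, ← hz, ← hwb]
    have hconn := connectedT (D := i.D) (B9GeoLemma21KLevelV1.one_le_Mh i) (B9GeoLemma21KLevelV1.one_le_P i)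
    have htri := hconn.dist_triangle (u := blkOf i.D.toDomains z) (v := blkOf i.D.toDomains w) (w := β i.hN i.D i.hk y')
    have h1' := dist_blkOf_le_one_of_touch i htouch
    have e : ((bondT i.D).dist (blkOf i.D.toDomains z) (β i.hN i.D i.hk y') : ℝ)
        ≤ ((bondT i.D).dist (blkOf i.D.toDomains z) (blkOf i.D.toDomains w) : ℝ)
          + ((bondT i.D).dist (blkOf i.D.toDomains w) (β i.hN i.D i.hk y') : ℝ) := by exact_mod_cast htri
    have h1r : ((bondT i.D).dist (blkOf i.D.toDomains z) (blkOf i.D.toDomains w) : ℝ) ≤ 1 := by exact_mod_cast h1'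
    linarith
  have hexp : Real.exp (-(δ * (geo9K i).dist (ιB (blkOf i.D.toDomains w)) y')) ≤ Real.exp δ * Real.exp (-(δ * (geo9K i).dist y y')) := by
    rw [← Real.exp_add]
    have := mul_le_mul_of_nonneg_left hdist hδ
    exact Real.exp_le_exp.2 (by linarith)
  calc ‖cdsS i V μ (O Λ') z‖ ≤ ‖cdS i V μ (O Λ') w‖ := norm_cdsS_le_norm_cdS_shift i V hV μ _ z
    _ ≤ _ := h1
    _ ≤ B₀ * (((ℓ : ℝ) + 1) * ((ℓ : ℝ) + 1) ^ levY i z) * (Real.exp δ * Real.exp (-(δ * (geo9K i).dist y y'))) * (geo9K i).supNorm (Sum.inl f) := by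
        refine mul_le_mul_of_nonneg_right ?_ hF0
        exact mul_le_mul (mul_le_mul_of_nonneg_left hpow hB₀) hexp (Real.exp_pos _).le (by positivity)
    _ = _ := by ring

end Entries

/-! ## §1 The forward gradient of a localized term: (3.100) and the bound «with (Lʲη)² replaced by Lʲη» -/

section Grad

variable (V : CfgY 𝔸 i)

/-- **(3.100), THE LATTICE LEIBNIZ RULE OF `∇_{V,μ}` THROUGH A SCALAR CUT-OFF**, in def-Y's letters:
`∇_{V,μ}(hΨ)(z) = h(z+e_μ)·(∇_{V,μ}Ψ)(z) + (h(z+e_μ) − h(z))·Ψ(z)`. [cite: Balaban1985BackgroundPropagators, (3.100) p.413, (3.3) p.390] -/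
theorem cdS_cutMulY_eq (μ : Fin (d + 1)) (h : SiteY i → ℝ) (Ψ : SiteY i → 𝔸) (z : SiteY i) :
    cdS i V μ (cutMulY h Ψ) z = ((h (shiftY i μ z) : ℝ) : ℂ) • cdS i V μ Ψ z + (((h (shiftY i μ z) - h z : ℝ)) : ℂ) • Ψ z := by
  have e : cdS i V μ Ψ z = R (UboxY i V μ z) (Ψ (shiftY i μ z)) - Ψ z := rfl
  rw [cdS_cutMulY_apply, e, Complex.ofReal_sub, sub_smul, smul_sub]
  abel

/-- the localized term's gradient VANISHES away from `supp h_□`: if `h(z+e_μ) = 0` and `h(z) = 0` then `∇_{V,μ}(hΨ)(z) = 0`.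
[cite: Balaban1985BackgroundPropagators, (3.87) p.409, (3.100) p.413, bookkeeping] -/
theorem cdS_hOh_eq_zero_of_far (μ : Fin (d + 1)) (h : SiteY i → ℝ) (Ψ : SiteY i → 𝔸) (z : SiteY i) (h1 : h (shiftY i μ z) = 0) (h0 : h z = 0) :
    cdS i V μ (cutMulY h Ψ) z = 0 := by
  rw [cdS_cutMulY_eq, h1, h0, sub_zero, Complex.ofReal_zero, zero_smul, zero_smul, add_zero]

/-- **OUTPUT LOCALISATION OF THE GRADIENT TERM**: `∇_{V,μ}(h_□Ψ)(z) ≠ 0 ⟹ Δ(z) ∈ QT □` and `lev z ≤ j + 1`.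
[cite: Balaban1985BackgroundPropagators, (3.87) p.409, (3.91) p.410; Balaban1984PropagatorsII, p.235] -/
theorem mem_QT_of_cdS_hOh_ne_zero (c : ↥(cubes i.D.toDomains)) (μ : Fin (d + 1)) (Ψ : SiteY i → 𝔸) (z : SiteY i)
    (hz : cdS i V μ (cutMulY (hTY i c) Ψ) z ≠ 0) :
    blkOf i.D.toDomains z ∈ QT i.D (B9GeoLemma21KLevelV1.one_le_Mh i) (four_le_P' i) c ∧ levY i z ≤ c.1.1 + 1 := by
  by_cases h1 : hTY i c (shiftY i μ z) = 0
  · by_cases h0 : hTY i c z = 0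
    · exact absurd (cdS_hOh_eq_zero_of_far i V μ (hTY i c) Ψ z h1 h0) hz
    · exact mem_QT_and_lev_of_near i c (z := z) (u' := z) h0 (torusSupNorm_sub_self_le_one i z)
  · exact mem_QT_and_lev_of_near i c (z := z) (u' := shiftY i μ z) h1 (torusSupNorm_sub_shiftY_le_one i μ z).1

variable (O : (SiteY i → 𝔸) →ₗ[ℂ] (SiteY i → 𝔸)) {B₀ δ : ℝ}

/-- ★★ **THE GRADIENT ENTRY OF THE LOCALIZED TERM `h_□G′_□h_□`, POINTWISE OVER THE CLASS**: for a cube letter `O` with (3.42)₀,₁ displayed, the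
cut-off `h_□` of the partition of record, `η = |c_f|⁻¹`: `η‖∇_{V,μ}(h_□O(h_□Λ))(z)‖ ≤ B₀(1 + (5∕8)·C1F∕M_h)·ℓ(y)·e^{−δd(y,y′)}·|f|` for `z ∈ Δ(βy)`,
`‖Λ‖ ≤ |f|`, `supp f ⊂ Δ(βy′)` — the main term by (3.42)₁ for `O` at `h_□Λ`, the commutator `(∂_μh_□)·O(h_□Λ)` by `|∂h_□| ≤ C1F∕(8∕5·S_j)` against
(3.42)₀ and `ℓ(y)∕η = L^{lev z} ≤ L^{j+1}` one step from `supp h_□` («O(M⁻¹)», [4] (2.44)).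
[cite: Balaban1985BackgroundPropagators, (3.100) p.413, (3.87)–(3.90) pp.409–410, (3.42) p.397; Balaban1984PropagatorsII, (2.44) p.230, p.234] -/
theorem eta_norm_cdS_hOh_le (c : ↥(cubes i.D.toDomains)) (hB₀ : 0 ≤ B₀) (hη : etaS i = |i.cf|⁻¹)
    (h342₀ : ∀ (f : SiteY i → ℝ) (y y' : IBondY i), (geo9K i).suppIn (Sum.inl f) y' →
      ∀ Λ : SiteY i → 𝔸, (∀ z, ‖Λ z‖ ≤ |f z|) → ∀ z : SiteY i, blkOf i.D.toDomains z = β i.hN i.D i.hk y →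
        etaS i ^ 2 * ‖O Λ z‖ ≤ B₀ * (geo9K i).len y ^ 2 * Real.exp (-(δ * (geo9K i).dist y y')) * (geo9K i).supNorm (Sum.inl f))
    (h342₁ : ∀ (f : SiteY i → ℝ) (y y' : IBondY i), (geo9K i).suppIn (Sum.inl f) y' →
      ∀ Λ : SiteY i → 𝔸, (∀ z, ‖Λ z‖ ≤ |f z|) → ∀ (z : SiteY i) (μ : Fin (d + 1)), blkOf i.D.toDomains z = β i.hN i.D i.hk y →
        etaS i * ‖cdS i V μ (O Λ) z‖ ≤ B₀ * (geo9K i).len y * Real.exp (-(δ * (geo9K i).dist y y')) * (geo9K i).supNorm (Sum.inl f))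
    (f : SiteY i → ℝ) (y y' : IBondY i) (hs : (geo9K i).suppIn (Sum.inl f) y')
    (Λ : SiteY i → 𝔸) (hΛ : ∀ z, ‖Λ z‖ ≤ |f z|) (z : SiteY i) (μ : Fin (d + 1)) (hz : blkOf i.D.toDomains z = β i.hN i.D i.hk y) :
    etaS i * ‖cdS i V μ (cutMulY (hTY i c) (O (cutMulY (hTY i c) Λ))) z‖
      ≤ B₀ * (1 + 5 / 8 * C1F d ℓ / i.Mh) * (geo9K i).len y * Real.exp (-(δ * (geo9K i).dist y y')) * (geo9K i).supNorm (Sum.inl f) := by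
  obtain ⟨_, hMh2, _, _⟩ := side_conditions i
  have hη0 : 0 < etaS i := etaS_pos i
  have hL1 : (1 : ℝ) ≤ (ℓ : ℝ) + 1 := by linarith [(Nat.cast_nonneg ℓ : (0 : ℝ) ≤ ℓ)]
  have hM : (0 : ℝ) < i.Mh := by exact_mod_cast (lt_of_lt_of_le (by norm_num) hMh2)
  have hE0 : 0 ≤ Real.exp (-(δ * (geo9K i).dist y y')) := (Real.exp_pos _).le
  have hF0 : 0 ≤ (geo9K i).supNorm (Sum.inl f) := geo9K_supNorm_nonneg i _
  have hleny : 0 ≤ (geo9K i).len y := (B6KLevelCensusIndexV1.len_pos i y).le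
  have hRHS : 0 ≤ B₀ * (1 + 5 / 8 * C1F d ℓ / i.Mh) * (geo9K i).len y * Real.exp (-(δ * (geo9K i).dist y y')) * (geo9K i).supNorm (Sum.inl f) := by
    have := C1F_nonneg d ℓ; positivity
  set h : SiteY i → ℝ := hTY i c with hh
  set Ψ : SiteY i → 𝔸 := O (cutMulY h Λ) with hΨ
  -- away from `supp h_□` the term vanishes
  by_cases hfar : h (shiftY i μ z) = 0 ∧ h z = 0
  · rw [cdS_hOh_eq_zero_of_far i V μ h Ψ z hfar.1 hfar.2, norm_zero, mul_zero]; exact hRHS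
  -- near `supp h_□`: the level of `z` is at most `j + 1`
  have hnear : levY i z ≤ c.1.1 + 1 := by
    rcases not_and_or.1 hfar with h1 | h0
    · exact (mem_QT_and_lev_of_near i c (z := z) (u' := shiftY i μ z) h1 (torusSupNorm_sub_shiftY_le_one i μ z).1).2
    · exact (mem_QT_and_lev_of_near i c (z := z) (u' := z) h0 (torusSupNorm_sub_self_le_one i z)).2
  -- the profile of `h_□Λ`, the two entries
  have hh1 : ∀ w, |h w| ≤ 1 := fun w => abs_hT_le_one i.D (B9GeoLemma21KLevelV1.one_le_Mh i) (B9GeoLemma21KLevelV1.one_le_P i) c w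
  have hΛ' : ∀ w, ‖cutMulY h Λ w‖ ≤ |f w| := norm_cutMulY_le_of_le hh1 hΛ
  have hgrad := norm_cdS_O_le_at i V O hη h342₁ f y y' hs _ hΛ' z μ hz
  have hval := norm_O_le_at i O hη h342₀ f y y' hs _ hΛ' z hz
  -- the Leibniz split and the two norms
  rw [cdS_cutMulY_eq]
  have hκ := abs_hTY_shiftY_sub_le i c μ z
  set κ₁ : ℝ := C1F d ℓ / (8 / 5 * (bigSide ℓ i.Mh c.1.1 : ℝ)) with hκ₁
  have hlen : (geo9K i).len y = ((ℓ : ℝ) + 1) ^ levY i z * etaS i := len_eq_pow_mul_eta i hη hz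
  -- `κ₁ · L^{lev z} ≤ (5/8)·C1F/M_h`
  have hκpow : κ₁ * ((ℓ : ℝ) + 1) ^ levY i z ≤ 5 / 8 * C1F d ℓ / i.Mh := by
    rw [hκ₁, C1F_div_bigSide_eq i c.1.1]
    have hLj : (0 : ℝ) < ((ℓ : ℝ) + 1) ^ c.1.1 := pow_pos (by linarith) _
    have hq : (((ℓ : ℝ) + 1) ^ c.1.1)⁻¹ * ((ℓ : ℝ) + 1) ^ levY i z ≤ (ℓ : ℝ) + 1 := by
      rw [inv_mul_le_iff₀ hLj]
      calc ((ℓ : ℝ) + 1) ^ levY i z ≤ ((ℓ : ℝ) + 1) ^ (c.1.1 + 1) := pow_le_pow_right₀ hL1 hnear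
        _ = ((ℓ : ℝ) + 1) ^ c.1.1 * ((ℓ : ℝ) + 1) := pow_succ _ _
    have hC := C1F_nonneg d ℓ
    calc 5 / 8 * C1F d ℓ / (((ℓ : ℝ) + 1) * i.Mh) * (((ℓ : ℝ) + 1) ^ c.1.1)⁻¹ * ((ℓ : ℝ) + 1) ^ levY i z
        = 5 / 8 * C1F d ℓ / (((ℓ : ℝ) + 1) * i.Mh) * ((((ℓ : ℝ) + 1) ^ c.1.1)⁻¹ * ((ℓ : ℝ) + 1) ^ levY i z) := by ring
      _ ≤ 5 / 8 * C1F d ℓ / (((ℓ : ℝ) + 1) * i.Mh) * ((ℓ : ℝ) + 1) := mul_le_mul_of_nonneg_left hq (by positivity)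
      _ = 5 / 8 * C1F d ℓ / i.Mh := by field_simp
  calc etaS i * ‖((h (shiftY i μ z) : ℝ) : ℂ) • cdS i V μ Ψ z + (((h (shiftY i μ z) - h z : ℝ)) : ℂ) • Ψ z‖
      ≤ etaS i * (|h (shiftY i μ z)| * ‖cdS i V μ Ψ z‖ + |h (shiftY i μ z) - h z| * ‖Ψ z‖) := by
        refine mul_le_mul_of_nonneg_left ((norm_add_le _ _).trans (add_le_add ?_ ?_)) hη0.le
        · rw [norm_ofReal_smul]
        · rw [norm_ofReal_smul]
    _ ≤ etaS i * (1 * (B₀ * ((ℓ : ℝ) + 1) ^ levY i z * Real.exp (-(δ * (geo9K i).dist y y')) * (geo9K i).supNorm (Sum.inl f))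
          + κ₁ * (B₀ * (((ℓ : ℝ) + 1) ^ levY i z) ^ 2 * Real.exp (-(δ * (geo9K i).dist y y')) * (geo9K i).supNorm (Sum.inl f))) := by
        refine mul_le_mul_of_nonneg_left (add_le_add ?_ ?_) hη0.le
        · exact mul_le_mul (hh1 _) hgrad (norm_nonneg _) zero_le_one
        · exact mul_le_mul hκ hval (norm_nonneg _) (le_trans (abs_nonneg _) hκ)
    _ = B₀ * (1 + κ₁ * ((ℓ : ℝ) + 1) ^ levY i z) * (((ℓ : ℝ) + 1) ^ levY i z * etaS i) * Real.exp (-(δ * (geo9K i).dist y y'))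
          * (geo9K i).supNorm (Sum.inl f) := by ring
    _ ≤ B₀ * (1 + 5 / 8 * C1F d ℓ / i.Mh) * (((ℓ : ℝ) + 1) ^ levY i z * etaS i) * Real.exp (-(δ * (geo9K i).dist y y'))
          * (geo9K i).supNorm (Sum.inl f) := by
        have h3 : 0 ≤ (((ℓ : ℝ) + 1) ^ levY i z * etaS i) := by positivity
        refine mul_le_mul_of_nonneg_right (mul_le_mul_of_nonneg_right (mul_le_mul_of_nonneg_right ?_ h3) hE0) hF0
        exact mul_le_mul_of_nonneg_left (by linarith) hB₀
    _ = _ := by rw [← hlen]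

end Grad

/-! ## §2 The Laplacian of a localized term: the first line of (3.88) and the bound with weight `1` -/

section Lap

variable (V : CfgY 𝔸 i)

/-- **`Δ_V(hΨ)(z) = h(z)(Δ_VΨ)(z) − (K_Δ(h)Ψ)(z)`** — the first line of (3.88) at def-Y's covariant Laplacian (`K_Δ(h) = cutCommY h (lapSL V)`, p38).
[cite: Balaban1985BackgroundPropagators, (3.88) p.409 (first line), (3.23) p.394] -/
theorem lapS_cutMulY_eq (h : SiteY i → ℝ) (Ψ : SiteY i → 𝔸) (z : SiteY i) :
    lapS i V (cutMulY h Ψ) z = ((h z : ℝ) : ℂ) • lapS i V Ψ z - cutCommY h (lapSL i V) Ψ z := by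
  rw [cutCommY_apply, lapSL_apply, lapSL_apply, sub_sub_cancel]

/-- the localized term's Laplacian VANISHES away from `supp h_□`: if `h` vanishes at `z` and at its `2(d+1)` lattice neighbours then `Δ_V(hΨ)(z) = 0`.
[cite: Balaban1985BackgroundPropagators, (3.87) p.409, (3.23) p.394, bookkeeping] -/
theorem lapS_hOh_eq_zero_of_far (h : SiteY i → ℝ) (Ψ : SiteY i → 𝔸) (z : SiteY i) (h0 : h z = 0)
    (hp : ∀ μ : Fin (d + 1), h (shiftY i μ z) = 0) (hm : ∀ μ : Fin (d + 1), h ((shiftY i μ).symm z) = 0) :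
    lapS i V (cutMulY h Ψ) z = 0 := by
  show (∑ μ : Fin (d + 1), cdsS i V μ (cdS i V μ (cutMulY h Ψ)) z) = 0
  refine Finset.sum_eq_zero fun μ _ => ?_
  rw [cdsS_cdS_cutMulY_apply, h0, hp μ, hm μ, Complex.ofReal_zero, zero_smul, zero_smul, zero_smul, smul_zero, sub_zero, sub_zero]

/-- **OUTPUT LOCALISATION OF THE LAPLACIAN TERM**: `Δ_V(h_□Ψ)(z) ≠ 0 ⟹ Δ(z) ∈ QT □` and `lev z ≤ j + 1`.
[cite: Balaban1985BackgroundPropagators, (3.87) p.409, (3.91) p.410; Balaban1984PropagatorsII, p.235] -/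
theorem mem_QT_of_lapS_hOh_ne_zero (c : ↥(cubes i.D.toDomains)) (Ψ : SiteY i → 𝔸) (z : SiteY i)
    (hz : lapS i V (cutMulY (hTY i c) Ψ) z ≠ 0) :
    blkOf i.D.toDomains z ∈ QT i.D (B9GeoLemma21KLevelV1.one_le_Mh i) (four_le_P' i) c ∧ levY i z ≤ c.1.1 + 1 := by
  by_cases h0 : hTY i c z = 0
  · by_cases hp : ∀ μ : Fin (d + 1), hTY i c (shiftY i μ z) = 0
    · by_cases hm : ∀ μ : Fin (d + 1), hTY i c ((shiftY i μ).symm z) = 0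
      · exact absurd (lapS_hOh_eq_zero_of_far i V (hTY i c) Ψ z h0 hp hm) hz
      · push Not at hm
        obtain ⟨μ, hμ⟩ := hm
        exact mem_QT_and_lev_of_near i c (z := z) (u' := (shiftY i μ).symm z) hμ (torusSupNorm_sub_shiftY_le_one i μ z).2
    · push Not at hp
      obtain ⟨μ, hμ⟩ := hp
      exact mem_QT_and_lev_of_near i c (z := z) (u' := shiftY i μ z) hμ (torusSupNorm_sub_shiftY_le_one i μ z).1
  · exact mem_QT_and_lev_of_near i c (z := z) (u' := z) h0 (torusSupNorm_sub_self_le_one i z)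

variable (O : (SiteY i → 𝔸) →ₗ[ℂ] (SiteY i → 𝔸)) {B₀ δ : ℝ}

/-- ★★ **THE LAPLACIAN ENTRY OF THE LOCALIZED TERM `h_□G′_□h_□`, POINTWISE OVER THE CLASS**: for a cube letter `O` with (3.42)₀,₁,₃ displayed, bi-contractive
bond variables, `η = |c_f|⁻¹`, a corner-free member: `‖Δ_V(h_□O(h_□Λ))(z)‖ ≤ (B₀ + θ₃₈₉∕(L·M_h))·e^{−δd(y,y′)}·|f|` for `z ∈ Δ(βy)`, `‖Λ‖ ≤ |f|`,
`supp f ⊂ Δ(βy′)` — the main term `h_□(z)Δ_V(O(h_□Λ))(z)` by (3.42)₃ for `O`, the commutator `K_Δ(h_□)` by the first line of (3.88) sized in print's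
shape (p38's `norm_cutCommY_lapSL_apply_le_grad`: `|∂h_□|` against the gradient entries, `|Δh_□|` against the value entry; the backward bond at the
neighbour `z − e_μ`) and the level bookkeeping `arith389` (`lev z ≤ j + 1` near `supp h_□`; `θ₃₈₉ = B₀(2(d+1)(5∕8)C1F·e^{δ}L² + (d+1)(5∕8)²C2F·L² + sLipT)`).
[cite: Balaban1985BackgroundPropagators, (3.88) p.409, (3.87)–(3.90) pp.409–410, (3.42) p.397 (fourth member); Balaban1984PropagatorsII, (2.40)∕(2.44) p.230] -/
theorem norm_lapS_hOh_le (c : ↥(cubes i.D.toDomains)) (hB₀ : 0 ≤ B₀) (hδ : 0 ≤ δ) (hη : etaS i = |i.cf|⁻¹)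
    (ιB : BlkY i → IBondY i) (hι : ∀ s, β i.hN i.D i.hk (ιB s) = s)
    (hV : ∀ (μ : Fin (d + 1)) (x : SiteY i), ‖(UboxY i V μ x : 𝔸)‖ ≤ 1 ∧ ‖(((UboxY i V μ x)⁻¹ : 𝔸ˣ) : 𝔸)‖ ≤ 1)
    (h342₀ : ∀ (f : SiteY i → ℝ) (y y' : IBondY i), (geo9K i).suppIn (Sum.inl f) y' →
      ∀ Λ : SiteY i → 𝔸, (∀ z, ‖Λ z‖ ≤ |f z|) → ∀ z : SiteY i, blkOf i.D.toDomains z = β i.hN i.D i.hk y →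
        etaS i ^ 2 * ‖O Λ z‖ ≤ B₀ * (geo9K i).len y ^ 2 * Real.exp (-(δ * (geo9K i).dist y y')) * (geo9K i).supNorm (Sum.inl f))
    (h342₁ : ∀ (f : SiteY i → ℝ) (y y' : IBondY i), (geo9K i).suppIn (Sum.inl f) y' →
      ∀ Λ : SiteY i → 𝔸, (∀ z, ‖Λ z‖ ≤ |f z|) → ∀ (z : SiteY i) (μ : Fin (d + 1)), blkOf i.D.toDomains z = β i.hN i.D i.hk y →
        etaS i * ‖cdS i V μ (O Λ) z‖ ≤ B₀ * (geo9K i).len y * Real.exp (-(δ * (geo9K i).dist y y')) * (geo9K i).supNorm (Sum.inl f))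
    (h342₃ : ∀ (f : SiteY i → ℝ) (y y' : IBondY i), (geo9K i).suppIn (Sum.inl f) y' →
      ∀ Λ : SiteY i → 𝔸, (∀ z, ‖Λ z‖ ≤ |f z|) → ∀ z : SiteY i, blkOf i.D.toDomains z = β i.hN i.D i.hk y →
        ‖lapS i V (O Λ) z‖ ≤ B₀ * 1 * Real.exp (-(δ * (geo9K i).dist y y')) * (geo9K i).supNorm (Sum.inl f))
    (f : SiteY i → ℝ) (y y' : IBondY i) (hs : (geo9K i).suppIn (Sum.inl f) y')
    (Λ : SiteY i → 𝔸) (hΛ : ∀ z, ‖Λ z‖ ≤ |f z|) (z : SiteY i) (hz : blkOf i.D.toDomains z = β i.hN i.D i.hk y) :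
    ‖lapS i V (cutMulY (hTY i c) (O (cutMulY (hTY i c) Λ))) z‖
      ≤ (B₀ + theta389 d ℓ B₀ δ / (((ℓ : ℝ) + 1) * i.Mh)) * Real.exp (-(δ * (geo9K i).dist y y')) * (geo9K i).supNorm (Sum.inl f) := by
  obtain ⟨_, hMh2, _, _⟩ := side_conditions i
  have hL1 : (1 : ℝ) ≤ (ℓ : ℝ) + 1 := by linarith [(Nat.cast_nonneg ℓ : (0 : ℝ) ≤ ℓ)]
  have hMh1 : (1 : ℝ) ≤ i.Mh := by exact_mod_cast (le_trans (by norm_num) hMh2)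
  have hE0 : 0 ≤ Real.exp (-(δ * (geo9K i).dist y y')) := (Real.exp_pos _).le
  have hF0 : 0 ≤ (geo9K i).supNorm (Sum.inl f) := geo9K_supNorm_nonneg i _
  have hθ0 : 0 ≤ theta389 d ℓ B₀ δ / (((ℓ : ℝ) + 1) * i.Mh) := div_nonneg (theta389_nonneg d ℓ hB₀ δ) (by positivity)
  have hRHS : 0 ≤ (B₀ + theta389 d ℓ B₀ δ / (((ℓ : ℝ) + 1) * i.Mh)) * Real.exp (-(δ * (geo9K i).dist y y')) * (geo9K i).supNorm (Sum.inl f) := by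
    positivity
  set h : SiteY i → ℝ := hTY i c with hh
  set Ψ : SiteY i → 𝔸 := O (cutMulY h Λ) with hΨ
  -- away from `supp h_□` the term vanishes; near it the level is at most `j + 1`
  by_cases h0 : lapS i V (cutMulY h Ψ) z = 0
  · rw [h0, norm_zero]; exact hRHS
  have hlev : levY i z ≤ c.1.1 + 1 := (mem_QT_of_lapS_hOh_ne_zero i V c Ψ z h0).2
  -- the profile of `h_□Λ` and the entries of `O` at it
  have hh1 : ∀ w, |h w| ≤ 1 := fun w => abs_hT_le_one i.D (B9GeoLemma21KLevelV1.one_le_Mh i) (B9GeoLemma21KLevelV1.one_le_P i) c w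
  have hΛ' : ∀ w, ‖cutMulY h Λ w‖ ≤ |f w| := norm_cutMulY_le_of_le hh1 hΛ
  have hval := norm_O_le_at i O hη h342₀ f y y' hs _ hΛ' z hz
  have hgrad : ∀ μ, ‖cdS i V μ Ψ z‖ ≤ B₀ * ((ℓ : ℝ) + 1) ^ levY i z * Real.exp (-(δ * (geo9K i).dist y y')) * (geo9K i).supNorm (Sum.inl f) :=
    fun μ => norm_cdS_O_le_at i V O hη h342₁ f y y' hs _ hΛ' z μ hz
  have hgrad' : ∀ μ, ‖cdsS i V μ Ψ z‖
      ≤ B₀ * (((ℓ : ℝ) + 1) * Real.exp δ) * ((ℓ : ℝ) + 1) ^ levY i z * Real.exp (-(δ * (geo9K i).dist y y')) * (geo9K i).supNorm (Sum.inl f) :=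
    fun μ => norm_cdsS_O_le_at i V O hB₀ hδ hη ιB hι hV h342₁ f y y' hs _ hΛ' z μ hz
  have hlap := h342₃ f y y' hs _ hΛ' z hz
  -- the gradient entries under ONE constant `G₁ = B₀·(L·e^{δ})·L^{lev z}·e^{−δd}|f|`
  have hG₁ : ∀ μ : Fin (d + 1),
      ‖cdS i V μ Ψ z‖ ≤ B₀ * (((ℓ : ℝ) + 1) * Real.exp δ) * ((ℓ : ℝ) + 1) ^ levY i z * Real.exp (-(δ * (geo9K i).dist y y')) * (geo9K i).supNorm (Sum.inl f)
      ∧ ‖cdsS i V μ Ψ z‖ ≤ B₀ * (((ℓ : ℝ) + 1) * Real.exp δ) * ((ℓ : ℝ) + 1) ^ levY i z * Real.exp (-(δ * (geo9K i).dist y y')) * (geo9K i).supNorm (Sum.inl f) := by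
    intro μ
    refine ⟨(hgrad μ).trans ?_, hgrad' μ⟩
    have h1 : (1 : ℝ) ≤ ((ℓ : ℝ) + 1) * Real.exp δ := by
      have : (1 : ℝ) ≤ Real.exp δ := Real.one_le_exp hδ
      nlinarith
    have hb : 0 ≤ B₀ * ((ℓ : ℝ) + 1) ^ levY i z * Real.exp (-(δ * (geo9K i).dist y y')) * (geo9K i).supNorm (Sum.inl f) := by positivity
    calc B₀ * ((ℓ : ℝ) + 1) ^ levY i z * Real.exp (-(δ * (geo9K i).dist y y')) * (geo9K i).supNorm (Sum.inl f)
        = 1 * (B₀ * ((ℓ : ℝ) + 1) ^ levY i z * Real.exp (-(δ * (geo9K i).dist y y')) * (geo9K i).supNorm (Sum.inl f)) := (one_mul _).symm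
      _ ≤ (((ℓ : ℝ) + 1) * Real.exp δ) * (B₀ * ((ℓ : ℝ) + 1) ^ levY i z * Real.exp (-(δ * (geo9K i).dist y y')) * (geo9K i).supNorm (Sum.inl f)) :=
          mul_le_mul_of_nonneg_right h1 hb
      _ = _ := by ring
  -- the commutator `K_Δ(h_□)Ψ` in print's shape, then the two `κ`'s against the entries
  set κ₁ : ℝ := C1F d ℓ / (8 / 5 * (bigSide ℓ i.Mh c.1.1 : ℝ)) with hκ₁
  set G₁ : ℝ := B₀ * (((ℓ : ℝ) + 1) * Real.exp δ) * ((ℓ : ℝ) + 1) ^ levY i z * Real.exp (-(δ * (geo9K i).dist y y')) * (geo9K i).supNorm (Sum.inl f)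
    with hG₁d
  set G₀ : ℝ := B₀ * (((ℓ : ℝ) + 1) ^ levY i z) ^ 2 * Real.exp (-(δ * (geo9K i).dist y y')) * (geo9K i).supNorm (Sum.inl f) with hG₀d
  have hcomm : ‖cutCommY h (lapSL i V) Ψ z‖
      ≤ 2 * ((d : ℝ) + 1) * κ₁ * G₁ + ((d : ℝ) + 1) * (C2F d ℓ / (8 / 5 * (bigSide ℓ i.Mh c.1.1 : ℝ)) ^ 2) * G₀ := by
    refine (norm_cutCommY_lapSL_apply_le_grad i V h Ψ z).trans (add_le_add ?_ ?_)
    · have hstep : ∀ μ : Fin (d + 1),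
          |h (shiftY i μ z) - h z| * ‖cdS i V μ Ψ z‖ + |h ((shiftY i μ).symm z) - h z| * ‖cdsS i V μ Ψ z‖ ≤ 2 * (κ₁ * G₁) := fun μ => by
        have h1 : |h (shiftY i μ z) - h z| * ‖cdS i V μ Ψ z‖ ≤ κ₁ * G₁ :=
          mul_le_mul (abs_hTY_shiftY_sub_le i c μ z) (hG₁ μ).1 (norm_nonneg _) (le_trans (abs_nonneg _) (abs_hTY_shiftY_sub_le i c μ z))
        have h2 : |h ((shiftY i μ).symm z) - h z| * ‖cdsS i V μ Ψ z‖ ≤ κ₁ * G₁ :=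
          mul_le_mul (abs_hTY_shiftY_symm_sub_le i c μ z) (hG₁ μ).2 (norm_nonneg _)
            (le_trans (abs_nonneg _) (abs_hTY_shiftY_symm_sub_le i c μ z))
        linarith
      refine (Finset.sum_le_sum fun μ _ => hstep μ).trans ?_
      rw [Finset.sum_const, Finset.card_univ, Fintype.card_fin, nsmul_eq_mul]
      push_cast
      exact le_of_eq (by ring)
    · exact mul_le_mul (abs_laplace_hTY_le i c z) hval (norm_nonneg _) (le_trans (abs_nonneg _) (abs_laplace_hTY_le i c z))
  -- level bookkeeping: the commutator is `≤ θ₃₈₉∕(L·M_h)·e^{−δd}|f|`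
  have hcomm' : ‖cutCommY h (lapSL i V) Ψ z‖
      ≤ theta389 d ℓ B₀ δ / (((ℓ : ℝ) + 1) * i.Mh) * Real.exp (-(δ * (geo9K i).dist y y')) * (geo9K i).supNorm (Sum.inl f) := by
    rw [hκ₁, C1F_div_bigSide_eq i c.1.1, C2F_div_bigSide_sq_eq i c.1.1, hG₁d, hG₀d] at hcomm
    have ht3 : 0 ≤ ((((ℓ : ℝ) + 1) ^ levY i z) ^ 2)⁻¹ * (sLipT d ℓ / (((ℓ : ℝ) + 1) * i.Mh))
        * (B₀ * (((ℓ : ℝ) + 1) ^ levY i z) ^ 2 * Real.exp (-(δ * (geo9K i).dist y y')) * (geo9K i).supNorm (Sum.inl f)) := by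
      have := sLipT_nonneg d ℓ; positivity
    have hX := hcomm.trans (le_add_of_nonneg_right ht3)
    have hX' : ‖cutCommY h (lapSL i V) Ψ z‖
        ≤ 2 * ((d : ℝ) + 1) * (5 / 8 * C1F d ℓ / (((ℓ : ℝ) + 1) * i.Mh) * (((ℓ : ℝ) + 1) ^ c.1.1)⁻¹)
            * (B₀ * (((ℓ : ℝ) + 1) * Real.exp δ) * ((ℓ : ℝ) + 1) ^ levY i z * Real.exp (-(δ * (geo9K i).dist y y')) * (geo9K i).supNorm (Sum.inl f))
          + ((d : ℝ) + 1) * ((5 / 8) ^ 2 * C2F d ℓ / (((ℓ : ℝ) + 1) * i.Mh) ^ 2 * (((((ℓ : ℝ) + 1) ^ c.1.1)) ^ 2)⁻¹)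
            * (B₀ * (((ℓ : ℝ) + 1) ^ levY i z) ^ 2 * Real.exp (-(δ * (geo9K i).dist y y')) * (geo9K i).supNorm (Sum.inl f))
          + ((((ℓ : ℝ) + 1) ^ levY i z) ^ 2)⁻¹ * (sLipT d ℓ / (((ℓ : ℝ) + 1) * i.Mh))
            * (B₀ * (((ℓ : ℝ) + 1) ^ levY i z) ^ 2 * Real.exp (-(δ * (geo9K i).dist y y')) * (geo9K i).supNorm (Sum.inl f)) :=
      hX.trans (le_of_eq (by ring))
    have hfin := arith389 (X := ‖cutCommY h (lapSL i V) Ψ z‖) (Nat.cast_nonneg d) hL1 hMh1 (C1F_nonneg d ℓ) (C2F_nonneg d ℓ) hB₀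
      (Real.exp_pos δ).le hE0 hF0 hlev hX'
    unfold theta389
    exact hfin
  -- assemble: `|h(z)|·‖Δ_VΨ(z)‖ + ‖K_Δ(h)Ψ(z)‖`
  rw [lapS_cutMulY_eq]
  calc ‖((h z : ℝ) : ℂ) • lapS i V Ψ z - cutCommY h (lapSL i V) Ψ z‖
      ≤ |h z| * ‖lapS i V Ψ z‖ + ‖cutCommY h (lapSL i V) Ψ z‖ := by
        refine (norm_sub_le _ _).trans (add_le_add (le_of_eq (norm_ofReal_smul _ _)) le_rfl)
    _ ≤ 1 * (B₀ * 1 * Real.exp (-(δ * (geo9K i).dist y y')) * (geo9K i).supNorm (Sum.inl f))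
        + theta389 d ℓ B₀ δ / (((ℓ : ℝ) + 1) * i.Mh) * Real.exp (-(δ * (geo9K i).dist y y')) * (geo9K i).supNorm (Sum.inl f) :=
        add_le_add (mul_le_mul (hh1 z) hlap (norm_nonneg _) zero_le_one) hcomm'
    _ = _ := by ring

end Lap

/-! ## §3 The two cube terms as LOCALIZED BLOCK MAJORANTS of the conjugated operators (the `KE μ □`, `KL □` of FILE 2) -/

section Majorants

variable (V : CfgY 𝔸 i) (O : (SiteY i → 𝔸) →ₗ[ℂ] (SiteY i → 𝔸)) {B₀ δ : ℝ}
variable [Fintype (geo9K i).Site] {Rr : ℝ} {Hp : Prop}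

omit [Fintype (geo9K i).Site] in
/-- an ℝ-linear `Rl` agreeing with `Λ ↦ η·∇_{V,μ}(h_□O(h_□Λ))` is ℂ-homogeneous. [cite: Balaban1985BackgroundPropagators, (3.87) p.409, bookkeeping] -/
theorem smul_comm_of_eq_grad (c : ↥(cubes i.D.toDomains)) (μ : Fin (d + 1)) (Rl : Module.End ℝ (SiteY i → 𝔸))
    (hRl : ∀ Λ z, Rl Λ z = ((etaS i : ℝ) : ℂ) • cdS i V μ (cutMulY (hTY i c) (O (cutMulY (hTY i c) Λ))) z) (a : ℂ) (Λ : SiteY i → 𝔸) :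
    Rl (a • Λ) = a • Rl Λ := by
  funext z
  rw [hRl, Pi.smul_apply, hRl, map_smul, map_smul, map_smul, cdS_smul, Pi.smul_apply, smul_comm]

omit [Fintype (geo9K i).Site] in
/-- an ℝ-linear `Rl` agreeing with `Λ ↦ Δ_V(h_□O(h_□Λ))` is ℂ-homogeneous. [cite: Balaban1985BackgroundPropagators, (3.87) p.409, bookkeeping] -/
theorem smul_comm_of_eq_lap (c : ↥(cubes i.D.toDomains)) (Rl : Module.End ℝ (SiteY i → 𝔸))
    (hRl : ∀ Λ z, Rl Λ z = lapS i V (cutMulY (hTY i c) (O (cutMulY (hTY i c) Λ))) z) (a : ℂ) (Λ : SiteY i → 𝔸) :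
    Rl (a • Λ) = a • Rl Λ := by
  funext z
  rw [hRl, Pi.smul_apply, hRl, map_smul, map_smul, map_smul, lapS_smul, Pi.smul_apply]

/-- ★★ **THE `KE μ □` SLOT OF FILE 2: the localized block majorant of the conjugated gradient term** — for a cube letter `O` with (3.42)₀,₁ displayed,
an ℝ-linear `Rl` with `Rl Λ = η·∇_{V,μ}(h_□O(h_□Λ))`, a real basis `b` (coordinate bound `M₂`), a corner-free member and ANY `S ⊇ {a : βa ∈ QT □}`:
`conj b Rl` has the majorant `1[a ∈ S]·M₂(Σ_j‖b_j‖)·B₀(1 + (5∕8)C1F∕M_h)·ℓ(a)·e^{−δd(a,a′)}` (off `S` the term vanishes on the block).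
[cite: Balaban1985BackgroundPropagators, (3.87)–(3.90) pp.409–410, (3.42)₂ p.397; Balaban1984PropagatorsII, (2.51) p.232, p.234] -/
theorem hasMajorant_conj_gradTerm (c : ↥(cubes i.D.toDomains)) (μ : Fin (d + 1)) (hB₀ : 0 ≤ B₀) (hη : etaS i = |i.cf|⁻¹)
    (ιB : BlkY i → IBondY i) (hι : ∀ s, β i.hN i.D i.hk (ιB s) = s)
    (h342₀ : ∀ (f : SiteY i → ℝ) (y y' : IBondY i), (geo9K i).suppIn (Sum.inl f) y' →
      ∀ Λ : SiteY i → 𝔸, (∀ z, ‖Λ z‖ ≤ |f z|) → ∀ z : SiteY i, blkOf i.D.toDomains z = β i.hN i.D i.hk y →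
        etaS i ^ 2 * ‖O Λ z‖ ≤ B₀ * (geo9K i).len y ^ 2 * Real.exp (-(δ * (geo9K i).dist y y')) * (geo9K i).supNorm (Sum.inl f))
    (h342₁ : ∀ (f : SiteY i → ℝ) (y y' : IBondY i), (geo9K i).suppIn (Sum.inl f) y' →
      ∀ Λ : SiteY i → 𝔸, (∀ z, ‖Λ z‖ ≤ |f z|) → ∀ (z : SiteY i) (μ : Fin (d + 1)), blkOf i.D.toDomains z = β i.hN i.D i.hk y →
        etaS i * ‖cdS i V μ (O Λ) z‖ ≤ B₀ * (geo9K i).len y * Real.exp (-(δ * (geo9K i).dist y y')) * (geo9K i).supNorm (Sum.inl f))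
    {M₂ : ℝ} (hM₂ : 0 ≤ M₂) (hrepr : ∀ (v : 𝔸) (j : ι), |b.repr v j| ≤ M₂ * ‖v‖)
    (Rl : Module.End ℝ (SiteY i → 𝔸))
    (hRl : ∀ Λ z, Rl Λ z = ((etaS i : ℝ) : ℂ) • cdS i V μ (cutMulY (hTY i c) (O (cutMulY (hTY i c) Λ))) z)
    (S : Finset (IBondY i)) (hS : ∀ a : IBondY i, β i.hN i.D i.hk a ∈ QT i.D (B9GeoLemma21KLevelV1.one_le_Mh i) (four_le_P' i) c → a ∈ S) :
    HasMajorant (g := toB6 (geo9K i) Rr Hp) (fun p : SiteY i × ι => ιB (blkOf i.D.toDomains p.1)) (conj b Rl)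
      (fun a a' => if a ∈ S then M₂ * (∑ j, ‖b j‖) * (B₀ * (1 + 5 / 8 * C1F d ℓ / i.Mh)) * (geo9K i).len a * Real.exp (-(δ * (geo9K i).dist a a'))
        else 0) := by
  classical
  obtain ⟨_, hMh2, _, _⟩ := side_conditions i
  have hM : (0 : ℝ) < i.Mh := by exact_mod_cast (lt_of_lt_of_le (by norm_num) hMh2)
  have hθ : 0 ≤ B₀ * (1 + 5 / 8 * C1F d ℓ / i.Mh) := by have := C1F_nonneg d ℓ; positivity
  have hW : ∀ a a' : IBondY i,
      0 ≤ (if a ∈ S then B₀ * (1 + 5 / 8 * C1F d ℓ / i.Mh) * (geo9K i).len a * Real.exp (-(δ * (geo9K i).dist a a')) else 0) := fun a a' => by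
    split_ifs
    · exact mul_nonneg (mul_nonneg hθ (B6KLevelCensusIndexV1.len_pos i a).le) (Real.exp_pos _).le
    · exact le_rfl
  have hTW : ∀ (f : SiteY i → ℝ) (y y' : IBondY i), (geo9K i).suppIn (Sum.inl f) y' → ∀ E : 𝔸, ‖E‖ ≤ 1 →
      ∀ z : SiteY i, blkOf i.D.toDomains z = β i.hN i.D i.hk y → ‖Rl (liftY f E) z‖
        ≤ (if y ∈ S then B₀ * (1 + 5 / 8 * C1F d ℓ / i.Mh) * (geo9K i).len y * Real.exp (-(δ * (geo9K i).dist y y')) else 0)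
          * (geo9K i).supNorm (Sum.inl f) := by
    intro f y y' hs E hE z hz
    rw [hRl, norm_ofReal_smul, abs_of_pos (etaS_pos i)]
    by_cases hy : y ∈ S
    · rw [if_pos hy]
      exact (eta_norm_cdS_hOh_le i V O c hB₀ hη h342₀ h342₁ f y y' hs (liftY f E) (norm_liftY_le f hE) z μ hz).trans (le_of_eq (by ring))
    · have h0 : cdS i V μ (cutMulY (hTY i c) (O (cutMulY (hTY i c) (liftY f E)))) z = 0 := by
        by_contra hne
        have hmem := (mem_QT_of_cdS_hOh_ne_zero i V c μ _ z hne).1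
        rw [hz] at hmem
        exact hy (hS y hmem)
      rw [h0, norm_zero, mul_zero, if_neg hy, zero_mul]
  have h := OpsYRead342.hasMajorant_conj_of_ball_bound (Rr := Rr) (Hp := Hp) i b Rl (smul_comm_of_eq_grad i V O c μ Rl hRl) ιB hι hM₂ hrepr
    (fun a a' => if a ∈ S then B₀ * (1 + 5 / 8 * C1F d ℓ / i.Mh) * (geo9K i).len a * Real.exp (-(δ * (geo9K i).dist a a')) else 0) hW hTW
  refine hasMajorant_mono (g := toB6 (geo9K i) Rr Hp) _ h fun a a' => le_of_eq ?_
  show M₂ * (∑ j, ‖b j‖) * (if a ∈ S then B₀ * (1 + 5 / 8 * C1F d ℓ / i.Mh) * (geo9K i).len a * Real.exp (-(δ * (geo9K i).dist a a')) else 0) = _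
  split_ifs
  · ring
  · rw [mul_zero]

/-- ★★ **THE `KL □` SLOT OF FILE 2: the localized block majorant of the conjugated Laplacian term** — for a cube letter `O` with (3.42)₀,₁,₃ displayed,
bi-contractive bond variables, an ℝ-linear `Rl` with `Rl Λ = Δ_V(h_□O(h_□Λ))`, a real basis `b` and ANY `S ⊇ {a : βa ∈ QT □}`: `conj b Rl` has the
majorant `1[a ∈ S]·M₂(Σ_j‖b_j‖)·(B₀ + θ₃₈₉∕(L·M_h))·e^{−δd(a,a′)}`.
[cite: Balaban1985BackgroundPropagators, (3.87)–(3.90) pp.409–410, (3.88) p.409, (3.42)₄ p.397; Balaban1984PropagatorsII, (2.51) p.232, (2.44) p.230] -/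
theorem hasMajorant_conj_lapTerm (c : ↥(cubes i.D.toDomains)) (hB₀ : 0 ≤ B₀) (hδ : 0 ≤ δ) (hη : etaS i = |i.cf|⁻¹)
    (ιB : BlkY i → IBondY i) (hι : ∀ s, β i.hN i.D i.hk (ιB s) = s)
    (hV : ∀ (μ : Fin (d + 1)) (x : SiteY i), ‖(UboxY i V μ x : 𝔸)‖ ≤ 1 ∧ ‖(((UboxY i V μ x)⁻¹ : 𝔸ˣ) : 𝔸)‖ ≤ 1)
    (h342₀ : ∀ (f : SiteY i → ℝ) (y y' : IBondY i), (geo9K i).suppIn (Sum.inl f) y' →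
      ∀ Λ : SiteY i → 𝔸, (∀ z, ‖Λ z‖ ≤ |f z|) → ∀ z : SiteY i, blkOf i.D.toDomains z = β i.hN i.D i.hk y →
        etaS i ^ 2 * ‖O Λ z‖ ≤ B₀ * (geo9K i).len y ^ 2 * Real.exp (-(δ * (geo9K i).dist y y')) * (geo9K i).supNorm (Sum.inl f))
    (h342₁ : ∀ (f : SiteY i → ℝ) (y y' : IBondY i), (geo9K i).suppIn (Sum.inl f) y' →
      ∀ Λ : SiteY i → 𝔸, (∀ z, ‖Λ z‖ ≤ |f z|) → ∀ (z : SiteY i) (μ : Fin (d + 1)), blkOf i.D.toDomains z = β i.hN i.D i.hk y →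
        etaS i * ‖cdS i V μ (O Λ) z‖ ≤ B₀ * (geo9K i).len y * Real.exp (-(δ * (geo9K i).dist y y')) * (geo9K i).supNorm (Sum.inl f))
    (h342₃ : ∀ (f : SiteY i → ℝ) (y y' : IBondY i), (geo9K i).suppIn (Sum.inl f) y' →
      ∀ Λ : SiteY i → 𝔸, (∀ z, ‖Λ z‖ ≤ |f z|) → ∀ z : SiteY i, blkOf i.D.toDomains z = β i.hN i.D i.hk y →
        ‖lapS i V (O Λ) z‖ ≤ B₀ * 1 * Real.exp (-(δ * (geo9K i).dist y y')) * (geo9K i).supNorm (Sum.inl f))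
    {M₂ : ℝ} (hM₂ : 0 ≤ M₂) (hrepr : ∀ (v : 𝔸) (j : ι), |b.repr v j| ≤ M₂ * ‖v‖)
    (Rl : Module.End ℝ (SiteY i → 𝔸)) (hRl : ∀ Λ z, Rl Λ z = lapS i V (cutMulY (hTY i c) (O (cutMulY (hTY i c) Λ))) z)
    (S : Finset (IBondY i)) (hS : ∀ a : IBondY i, β i.hN i.D i.hk a ∈ QT i.D (B9GeoLemma21KLevelV1.one_le_Mh i) (four_le_P' i) c → a ∈ S) :
    HasMajorant (g := toB6 (geo9K i) Rr Hp) (fun p : SiteY i × ι => ιB (blkOf i.D.toDomains p.1)) (conj b Rl)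
      (fun a a' => if a ∈ S then M₂ * (∑ j, ‖b j‖) * (B₀ + theta389 d ℓ B₀ δ / (((ℓ : ℝ) + 1) * i.Mh)) * Real.exp (-(δ * (geo9K i).dist a a'))
        else 0) := by
  classical
  obtain ⟨_, hMh2, _, _⟩ := side_conditions i
  have hθ : 0 ≤ B₀ + theta389 d ℓ B₀ δ / (((ℓ : ℝ) + 1) * i.Mh) := add_nonneg hB₀ (div_nonneg (theta389_nonneg d ℓ hB₀ δ) (by positivity))
  have hW : ∀ a a' : IBondY i,
      0 ≤ (if a ∈ S then (B₀ + theta389 d ℓ B₀ δ / (((ℓ : ℝ) + 1) * i.Mh)) * Real.exp (-(δ * (geo9K i).dist a a')) else 0) := fun a a' => by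
    split_ifs
    · exact mul_nonneg hθ (Real.exp_pos _).le
    · exact le_rfl
  have hTW : ∀ (f : SiteY i → ℝ) (y y' : IBondY i), (geo9K i).suppIn (Sum.inl f) y' → ∀ E : 𝔸, ‖E‖ ≤ 1 →
      ∀ z : SiteY i, blkOf i.D.toDomains z = β i.hN i.D i.hk y → ‖Rl (liftY f E) z‖
        ≤ (if y ∈ S then (B₀ + theta389 d ℓ B₀ δ / (((ℓ : ℝ) + 1) * i.Mh)) * Real.exp (-(δ * (geo9K i).dist y y')) else 0)
          * (geo9K i).supNorm (Sum.inl f) := by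
    intro f y y' hs E hE z hz
    rw [hRl]
    by_cases hy : y ∈ S
    · rw [if_pos hy]
      exact (norm_lapS_hOh_le i V O c hB₀ hδ hη ιB hι hV h342₀ h342₁ h342₃ f y y' hs (liftY f E) (norm_liftY_le f hE) z hz).trans (le_of_eq (by ring))
    · have h0 : lapS i V (cutMulY (hTY i c) (O (cutMulY (hTY i c) (liftY f E)))) z = 0 := by
        by_contra hne
        have hmem := (mem_QT_of_lapS_hOh_ne_zero i V c _ z hne).1
        rw [hz] at hmem
        exact hy (hS y hmem)
      rw [h0, norm_zero, if_neg hy, zero_mul]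
  have h := OpsYRead342.hasMajorant_conj_of_ball_bound (Rr := Rr) (Hp := Hp) i b Rl (smul_comm_of_eq_lap i V O c Rl hRl) ιB hι hM₂ hrepr
    (fun a a' => if a ∈ S then (B₀ + theta389 d ℓ B₀ δ / (((ℓ : ℝ) + 1) * i.Mh)) * Real.exp (-(δ * (geo9K i).dist a a')) else 0) hW hTW
  refine hasMajorant_mono (g := toB6 (geo9K i) Rr Hp) _ h fun a a' => le_of_eq ?_
  show M₂ * (∑ j, ‖b j‖) * (if a ∈ S then (B₀ + theta389 d ℓ B₀ δ / (((ℓ : ℝ) + 1) * i.Mh)) * Real.exp (-(δ * (geo9K i).dist a a')) else 0) = _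
  split_ifs
  · ring
  · rw [mul_zero]

end Majorants

end Literature.MathematicalPhysics.QuantumFieldTheory.Balaban1983to89.B9Thm37CutoffGradTerms

end
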